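import Summits.ResolutionOfSingularities.ResolutionOfSingularities.Theorems.FrobeniusClosingPatchingRelPerfectQuotientRegularityTools
import HarnessLib

/-!
# Crux `PatchingRelPerfect` (stmt-ResolutionOfSingularities-16161), chain w52 — rung toolkit:
# the Jacobian criterion for polynomial hypersurfaces, universe-polymorphic form

[OURS · L1 W5.2 · rung tool] `…QuotientRegularityTools.lean` states the Jacobian criterion
(`k[T]/(F)` is regular at every prime missing some `∂F/∂T_j`) with the variable type and the
coefficient ring in one universe.  The chart computations of rung r2pt need variables
`{j : Fin n // j ≠ i} : Type` over a residue ring `S ⧸ 𝔪 : Type u`; this file re-proves the two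
statements with independent universes (same proofs: tree `notMem_sq_maximalIdeal_of_pderiv_notMem`
and `isRegularLocalRing_localization_quotient_of_notMem_sq`).  Nothing here is a statement of the
manuscript under review.

## References

* H. Matsumura, *Commutative Ring Theory*, CUP 1986, Thm. 14.2. [Matsumura1987]
-/

-- `Summit.<Summit>.<Sub>.Theorems` with `Sub = Summit` (single-conjunct summit, D-0017)
set_option linter.dupNamespace false

noncomputable section

open IsLocalRing Literature.AlgebraicGeometry.Resolution

namespace Summit.ResolutionOfSingularities.ResolutionOfSingularities.Theorems

universe v w

/-! ## The Jacobian criterion with independent universes for variables and coefficients -/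

/-- **Jacobian criterion, pointwise** — as
`MvPolynomial.isRegularLocalRing_localization_quotient_of_pderiv_notMem`, with the variable type
and the coefficient ring in independent universes (needed for `σ = {j : Fin n // j ≠ i}` over a
residue ring in universe `u`). [cite: Matsumura1987, Thm. 14.2] -/
theorem MvPolynomial.isRegularLocalRing_atPrime_quotient_of_pderiv_notMem {σ : Type v}
    {k : Type w} [CommRing k] [IsRegularRing (MvPolynomial σ k)] {F : MvPolynomial σ k}
    (Qbar : Ideal (MvPolynomial σ k ⧸ Ideal.span {F})) [Qbar.IsPrime] (j : σ)
    (hj : Ideal.Quotient.mk (Ideal.span {F}) (MvPolynomial.pderiv j F) ∉ Qbar) :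
    IsRegularLocalRing (Localization.AtPrime Qbar) := by
  classical
  set Q : Ideal (MvPolynomial σ k) := Qbar.comap (Ideal.Quotient.mk (Ideal.span {F})) with hQ
  have hj' : (RingHom.id (MvPolynomial σ k)) (MvPolynomial.pderiv j F) ∉ Q := fun h =>
    hj (Ideal.mem_comap.mp h)
  have hf2 := notMem_sq_maximalIdeal_of_pderiv_notMem (RingHom.id (MvPolynomial σ k))
    Function.surjective_id ⊥
    (by intro p hp; rw [RingHom.mem_ker, RingHom.id_apply] at hp; rw [hp]; exact zero_mem _) Q
    (fun a ha => by rw [(Submodule.mem_bot k).mp ha, map_zero, map_zero]; exact Q.zero_mem)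
    j F hj'
  exact isRegularLocalRing_localization_quotient_of_notMem_sq Qbar hf2

/-- **Jacobian criterion, global**, with independent universes: if at every prime containing `F`
some partial derivative of `F` is non-zero, then `k[T]/(F)` is a regular ring.
[cite: Matsumura1987, Thm. 14.2] -/
theorem MvPolynomial.isRegularRing_quotient_span_of_pderiv {σ : Type v} {k : Type w} [CommRing k]
    [IsRegularRing (MvPolynomial σ k)] {F : MvPolynomial σ k}
    (h : ∀ (Q : Ideal (MvPolynomial σ k)), Q.IsPrime → F ∈ Q →
      ∃ j, MvPolynomial.pderiv j F ∉ Q) :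
    IsRegularRing (MvPolynomial σ k ⧸ Ideal.span {F}) := by
  haveI : IsNoetherianRing (MvPolynomial σ k ⧸ Ideal.span {F}) :=
    Ideal.Quotient.isNoetherianRing _
  rw [isRegularRing_iff]
  intro Qbar hQbar
  set Q : Ideal (MvPolynomial σ k) := Qbar.comap (Ideal.Quotient.mk (Ideal.span {F}))
  have hFQ : F ∈ Q := by
    change Ideal.Quotient.mk (Ideal.span {F}) F ∈ Qbar
    rw [Ideal.Quotient.eq_zero_iff_mem.mpr (Ideal.mem_span_singleton_self F)]
    exact Qbar.zero_mem
  obtain ⟨j, hj⟩ := h Q inferInstance hFQ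
  exact MvPolynomial.isRegularLocalRing_atPrime_quotient_of_pderiv_notMem Qbar j
    (fun hm => hj (Ideal.mem_comap.mpr hm))

end Summit.ResolutionOfSingularities.ResolutionOfSingularities.Theorems

end
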